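import Mathlib
import HarnessLib
import HarnessLib.Audit
import Summits.HodgeConjecture.Statement
import Literature.AlgebraicGeometry.HodgeTheory.FermatHodgeLines
import Literature.AlgebraicGeometry.HodgeTheory.DiagonalSymmetry
import Literature.AlgebraicGeometry.HodgeTheory.AlgebraicClasses
import Literature.AlgebraicGeometry.HodgeTheory.GysinFormalism
import Literature.AlgebraicGeometry.Motives.Sweep1
import Summits.HodgeConjecture.HodgeConjecture.Theorems.NodalSupportHodgeModels
import HarnessLib.Audit.Status.Attr

/-!
Route: GaloisSieve

DORMANT since 2026-08-26T05:43:26Z (reconciler: no traction for 8.4 d (last activity item-evidence-added at 2026-08-17T19:55:48Z); parked, not closed — `ledger route dormant route-HodgeConjecture-GaloisSieve --off` to reactivate) — unstaffed, not closed; items shared with open routes are served there. `ledger route dormant <id> --off` reactivates.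

# Route GaloisSieve — Hodge characters of Fermat towers live on torsion cosets — a
Galois-equidistribution sieve leaves finitely many coset families and a finite sporadic list

DECLARED SECTOR ROUTE (sector = all Fermat varieties Xⁿₘ : Σᵢ xᵢᵐ = 0, every dimension n and degree
m; frame to the summit = the explicit NOT-claimed support SectorComplement, as in
DerivedTorelliFermat / KugaSatakeSaturation). Card galois-equidistribution-sieve-hodge-cosets
(spine). By Shioda–Ran (tree: mem_algebraicClasses_fermat_middle_of_eigenspaces) HC for X²ᵖₘ is the
statement that every Hodge eigenline V(α), α ∈ 𝔅²ᵖₘ (FermatCharacter.IsHodge), consists of algebraic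
classes (target HodgeEigenlines). Read a Hodge character α = a/m as a TORSION POINT of the real
torus 𝕋 = {θ ∈ (ℝ/ℤ)²ᵖ⁺² : Σθᵢ = 0} constrained, with its whole Galois orbit (ℤ/m)ˣ·α, to the open
slab P = {Σ{θᵢ} = p+1, no θᵢ = 0}. α is ON A HODGE LINE (tree: FermatCharacter.OnHodgeLine) if for
some integer direction v ≠ 0 (Σvᵢ = 0) every translate α + (k/N)v with N coprime to m is again a
Hodge character (all conjugate-parallel circles lie in the closure of P); otherwise α is ISOLATED. α
is DECOMPOSABLE (Shioda; tree: FermatCharacter.IsDecomposable) if its value multiset splits into two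
non-empty Hodge multisets — such eigenlines come from lower-dimensional Fermat varieties of the same
degree by Shioda's inductive structure (support BlockCancellation, known), so only INDECOMPOSABLE
characters carry new content (this is the 2026-08-16 repair of the refuters' 'frozen Hodge block'
objection: with the old pair-free cut a frozen block beside a moving standard block put every
pair-free character on a line). It suffices to show X = CosetAlgebraicity ∧ SporadicAlgebraicity:
(C, rank 2) V(α) is algebraic for every indecomposable Hodge character of length 2p+2 ≥ 6 on a Hodge
line — the flat coset families (for p = 1 exactly Aoki–Shioda's standard elements αᵢ, βᵢ, γⱼ of
directions (1,1,−2,0), (1,1,2,−4), (1,1,1,−3); for p = 2 e.g. the genuinely length-6 line through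
(1,1,7,14,15,16)/18), uniformly in the level; (S, rank 3) V(α) is algebraic for every indecomposable
ISOLATED Hodge character of length ≥ 6 — by the SIEVE (crux SieveFiniteness, rank 4: Galois-orbit
equidistribution of torsion points forces isolated characters of each length to have bounded order;
p = 1 is Aoki's theorem with bound 180) a FINITE list per dimension, whose first open entry is da
Silva's m = 33 fourfold class (1,4,16,22,25,31). Decomposable characters reduce to lower dimension
(BlockCancellation) and Fermat surfaces are Lefschetz (1,1) (support FermatSurfaceEigenlines, a
landed fact), so C ∧ S give HodgeEigenlines for all p by strong induction (support glue
EigenlineInduction, proved in the planner folder), hence HC for every Fermat variety (FermatHC).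
Lean: `CosetAlgebraicity ∧ SporadicAlgebraicity`

## Assembly
CONE-CLEAN since the 2026-08-16 route repair: the route file imports only Statement +
FermatHodgeLines + DiagonalSymmetry + AlgebraicClasses + GysinFormalism + Sweep1 (69 project files,
NO unproved Literature fact; the 12 Kähler/Hodge-decomposition facts rode in on FermatDiagonalAction
→ DiagonalCharacterEigenspace → ComplexConjugation, and nonempty_hodgeModel on HodgeModelExistence).
Price: Shioda's eigenspace V(α) = fermatEigenspace m α k is spelled INLINE in every item as the
simultaneous eigenvectors of the maps g_a (DiagonalSymmetry.diagonalMap), `∀ a (ha : a ∈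
diagonalStabilizer F), (∀ i, a i ^ m = 1) → H(g_a) c = (∏ (a i : ℂ)^⟨αᵢ⟩) • c` — equal to `c ∈
fermatEigenspace m α k` by mem_fermatEigenspace_iff (planner evidence Bridge.lean / Delta.lean, rc
0: isEigInline_iff, and New.HodgeEigenlines ↔ Old.HodgeEigenlines, New ↔ Old for
FermatSurfaceEigenlines / EigenspaceInputs, Old.C → New.C, Old.S → New.S), so provers `rw
[isEigInline_iff]` once and use every fermatEigenspace theorem of the tree from Theorems/ (heavy
imports belong there, not in Theses/). Deciding theorem (items only, one line): `closes (hI :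
EigenlineInduction) (hK : BlockCancellation) (hB : FermatSurfaceEigenlines) (hC : CosetAlgebraicity)
(hS : SporadicAlgebraicity) (hE : EigenspaceInputs) (hL : HypersurfaceLefschetz) (hA :
EigenlineAssembly) (hM : FermatHodgeModels) (hSC : SectorComplement) : HodgeConjecture := hSC (fun n
m X hm hFV hX => ⟨hM n m X hm hFV hX, hA (hI hK hB hC hS) hL hE n m X hm hFV hX⟩)`. Step 1 =
EigenlineInduction (support glue to the target, PROVED in the planner sketch by strong induction on
p: p = 1 is hB; for p ≥ 2 a decomposable character is hK applied to the induction hypothesis at the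
lower dimensions 0 < q < p, an indecomposable one is on a Hodge line (hC) or isolated (hS) —
trichotomy by excluded middle, no sieve needed for the logic). Step 2 = EigenlineAssembly
(HodgeEigenlines → ‹body of HypersurfaceLefschetz› → ‹body of EigenspaceInputs› → every rational
(p,p)-class on every smooth projective Fermat variety is algebraic; candidate proof attached on the
item: algebraicClasses_zero / algebraicClasses_fermat_eq_top_of_two_mul_ne / transport along
IsFermatVariety.isoFermatHypersurface / mem_algebraicClasses_fermat_middle_of_eigenspaces, after the
bridge rewrite). The model conjunct of HodgeConjectureFor is the sector-restricted support
FermatHodgeModels (Hodge models of smooth projective Fermat varieties exist — GAGA + Hodge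
decomposition; the Literature fact nonempty_hodgeModel specialised, stated over HodgeConjecture.lean
only). Step 3: hSC. SieveFiniteness is not a hypothesis of `closes`: it is the crux that makes
SporadicAlgebraicity a finite list (and whose failure kills the line), staffed as such. Items state
the standard model as `SmoothHypersurface.hypersurface (fermatPolynomial ℂ n m)`.

Rationale: WHY THIS LINE. Shioda1979PJA/Shioda1979HodgeFermat/Ran1980 reduce HC(Xⁿₘ) to the combinatorics of
the Hodge characters 𝔅ⁿₘ plus cycle supply; the literature organises 𝔅ⁿₘ level by level (Shioda's
(Pₘ), Aoki1987's standard cycles, arXiv:2101.04739's failure of P₃₃) and ACROSS ALL LEVELS in full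
only for surfaces: Theorem (𝔅²ₘ) of Shioda 1982 / Aoki1983 / AokiShioda1983 (read: AokiShioda1983
pp. 1–3; now LANDED tree facts AokiShioda1983_thmB2m_coprime_six / _standard, p63115, and
AokiShioda1983_eigenline_le_neronSeveri, p63379) — three one-parameter families plus finitely many
exceptional characters, all of level ≤ 180. The card imports the standard unlikely-intersections
engine for torsion points of tori (Galois orbits of torsion points equidistribute — Weyl sums over
an orbit are Ramanujan sums μ(m′)/φ(m′) — unless a small frequency nearly annihilates the point;
BombieriGubler2001 §4.3 (Bilu's equidistribution theorem), KuipersNiederreiter1974 Ch. 2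
(Erdős–Turán–Koksma)) and points it at the Hodge side: a rational Hodge class in the Fermat tower is
a torsion point whose whole Galois orbit lies in an open polytope, so such points are special (on
torsion cosets inside the closed slab) or few. This yields, for EVERY length, the dichotomy that
Aoki proved by hand for length 4 — finitely many flat coset families + finitely many isolated
characters — together with an ℓ-division certificate of isolation whose blind run singles out da
Silva's m = 33 class (arXiv:2101.04739 Prop. 3.6) as the unique isolated orbit at level 33. Since
the 2026-08-16 repair the dichotomy is applied only to Shioda-INDECOMPOSABLE characters (three
refuter crux-attacks, rattack-12508/13876/13851, showed that with the pair-free cut a frozen Hodge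
block beside a moving standard block σ_{3,y} puts every pair-free character on a typed Hodge line,
so the old rank-2 crux absorbed the sporadic list modulo Aoki1987 Thm 1-4; decomposable characters
are Shioda's inductive structure, a known support). What the line does that prior routes do not:
DerivedTorelliFermat attacks Fermat FOURFOLDS through a K3 sector and a census-based exhaustion
crux, SupersingularIsotypicLift / PadicSemiregularLift go p-adic; none has a theorem in the tower
direction — here compactness across all degrees is the rank-4 crux and the HC content is split into
uniform families (rank 2) and a finite sporadic list (rank 3). Negatives index empty at filing and
at the repair.

RANKED CRUXES. #0 HodgeEigenlines (target) — for every p ≥ 1, m ≥ 1 and every Hodge character α ∈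
𝔅²ᵖₘ (all aᵢ ≠ 0, Σaᵢ = 0, Σ⟨taᵢ⟩ = m(p+1) for all units t) the eigenline V(α) ⊂ H²ᵖ(V₊(Σxᵢᵐ)(ℂ); ℂ)
(spelled inline as the simultaneous eigenvectors of the diagonal symmetries g_a, a ∈ μₘ²ᵖ⁺², with
eigencharacter ∏ aᵢ^⟨αᵢ⟩ — equal to fermatEigenspace m α (2p), evidence Delta.lean) consists of
algebraic classes; equivalent (given EigenspaceInputs) to HC for all Fermat 2p-folds (why it might
fail: instance family of HC — first suspects da Silva's isolated m = 33 class and Aoki's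
semi-standard elements). [Shioda1979PJA, Shioda1979HodgeFermat, Ran1980, Aoki1987, arXiv:2101.04739]
#2 CosetAlgebraicity (crux, card K1) — for every p ≥ 2, m ≥ 1 and every INDECOMPOSABLE Hodge
character α of length 2p+2 (¬ FermatCharacter.IsDecomposable of its value multiset: no splitting
into two non-empty Hodge multisets, Shioda1979PJA §1 Def. (i)) lying ON A HODGE LINE
(FermatCharacter.OnHodgeLine: an integer direction v ≠ 0, Σvᵢ = 0, with every level-mN translate N·a
+ m k v, N coprime to m, again Hodge) the eigenline V(α) is algebraic; engine uniform in the level: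
distribution relation ⇒ Hecke-character identity ⇒ isogeny of CM factors of Fermat Jacobians ⇒
correspondence (Aoki's standard cycles = Hasse–Davenport lines; Aoki–Shioda's curves on
quadrics/cubics/quartics for the three surface line types), transported by Shioda's inductive
structure (why it might fail: indecomposable Hodge lines of length ≥ 6 are unclassified — e.g. the
genuine length-6 line through (1,1,7,14,15,16)/18 — and Aoki's standard-cycle supply covers only
block directions; one uncovered type is open HC). [Aoki1987, AokiShioda1983, Aoki1991,
Shioda1979HodgeFermat, arXiv:2101.04739, Aoki2000FermatTypeHC] #3 SporadicAlgebraicity (crux, card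
K4) — for every p ≥ 2, m ≥ 1 and every indecomposable ISOLATED Hodge character α of length 2p+2 (¬
OnHodgeLine), V(α) is algebraic; by SieveFiniteness a FINITE list per p, first open entry da Silva's
(1,4,16,22,25,31)/33 (certified isolated: no Hodge 5- or 7-division neighbour; outside Shioda's P₃₃
and Aoki's supply, arXiv:2101.04739 Prop. 3.6 / Question 1); refuter censuses (items 13722/13234
evidence) give certified-isolated primitive length-6 orbits at m = 14:1 18:3 20:5 21:2 24:20 28:5
30:75–76 33:1 36:31 39:2 40:15 42:136–137 45:4 48:37 50:2 54:17 56:12 60:416 … 120:351, 168:87,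
180:100, 210:40, 240:76, with 43 of the 50 levels in 151..200 empty — each entry needs an individual
cycle (Newton-identity complete intersections, K3 correspondences, Villaflor periods) (why it might
fail: each isolated class needs its own cycle and the first one, da Silva's m = 33 class, is open;
one non-algebraic entry kills HC). [arXiv:2101.04739, Aoki1987, Aoki1983,
AljovinMovasatiVillaflor2019, Shioda1979HodgeFermat] #4 SieveFiniteness (crux, card P1, UNCHANGED) —
for every p ≥ 1 there is M₀(p) such that every isolated Hodge character of length 2p+2, of any level
m, has additive order ≤ M₀(p): Weyl criterion on the character torus with Ramanujan-sum bounds for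
Galois orbits, recursion inside the finitely many Galois-stable codimension-1 torsion cosets; depth
1 (m prime ⇒ paired) is PROVED in the tree (FermatCharacter.IsHodge.isPaired); p = 1 is Theorem
(𝔅²ₘ) with M₀(1) = 180 (refuter census m ≤ 360 reproduces the 101 exceptional orbits on 22 levels ≤
180 exactly); a refuter sketch (SieveFiniteness_sketch.md on the item) argues the ineffective
statement by compactness + equidistribution (why it might fail: the recursion in Galois-stable
sub-cosets is unwritten beyond length 4; p = 2 certified-isolated counts peak at 60:416 / 120:351
and an infinite isolated family kills it). [Aoki1983, AokiShioda1983, arXiv:2101.04739,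
KuipersNiederreiter1974, BombieriGubler2001, KoblitzOgus1979] #5 EffectiveSieveBound (informal, card
K2) — an explicit M₀(p); M₀(1) = 180, M₀(2) ≥ 240 by the censuses. SUPPORTS (rank 9):
BlockCancellation (known — Shioda1979HodgeFermat Thm I–II type-II inductive structure / Aoki1987 Thm
1-4 (i) / arXiv:2101.04739 Thm 2.2–Cor 2.3; replaces PairCancellation: if all Hodge eigenlines of
the Fermat 2q-folds of degree m, 0 < q < p, are algebraic then so is V(α) for every DECOMPOSABLE
Hodge character α of length 2p+2 — V(β ∗ γ) is the image of V(β) ⊗ V(γ) under the algebraic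
correspondence of the blow-up centre, pairs (q = 0 blocks) being linear-subspace classes);
FermatSurfaceEigenlines (known, p = 1 base: Lefschetz (1,1) in eigenline form = landed fact
AokiShioda1983_eigenline_le_neronSeveri); EigenspaceInputs (known; Ran1980 Prop. 1.7 (i)–(ii),
Shioda1979HodgeFermat (1.7): V(α) = 0 for α ≠ 0 with a zero coordinate, V(0) restricted from ℙ²ᵖ⁺¹,
norm-sum criterion for (p,p) eigenlines); HypersurfaceLefschetz (VoisinHodgeII2003 Cor. 1.24–1.25,
verbatim body of the tree fact Voisin2003_smoothHypersurface_algebraicClasses_eq_top);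
EigenlineInduction (glue to the target, PROVED in the planner sketch: BlockCancellation →
FermatSurfaceEigenlines → CosetAlgebraicity → SporadicAlgebraicity → HodgeEigenlines by strong
induction on p and the trichotomy decomposable | indecomposable on a line | indecomposable
isolated); EigenlineAssembly (provable now, candidate proof on the item: HodgeEigenlines + Lefschetz
+ eigenspace inputs ⇒ every rational (p,p)-class on every smooth projective Fermat variety is
algebraic, via mem_algebraicClasses_fermat_middle_of_eigenspaces after the bridge rewrite
isEigInline_iff); FermatHodgeModels (known, GAGA + Hodge decomposition = the Literature fact
nonempty_hodgeModel restricted to the sector, stated over HodgeConjecture.lean so that the route's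
import cone is fact-free); FermatHC (the sector statement, milestone); SectorComplement (NOT
claimed: FermatHC → HodgeConjecture, the declared sector frame).

TWO-LAYER PLAN. CosetAlgebraicity ⇐ LineTypes → FamilyCycles → CosetAlgebraicity, where LineTypes:
for each p the indecomposable Hodge lines of length 2p+2 form finitely many types up to S₂ₚ₊₂ ×
units (balanced speed configurations; p = 1: exactly Aoki–Shioda's three), and FamilyCycles: for
each type one correspondence uniform in the level (Hasse–Davenport/distribution relation ⇒ CM
isogeny ⇒ cycle). SporadicAlgebraicity ⇐ EffectiveSieveBound(p) → FiniteCensusCycles (cycles for the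
certified finite list, first entry m = 33, shared with DerivedTorelliFermat.Fermat33AccidentalClass
and card fermat-33-exact-cycle-search) → SporadicAlgebraicity. SieveFiniteness ⇐ DepthOneStep
(Erdős–Turán–Koksma with Ramanujan sums: large order ⇒ a bounded frequency has bounded order on α) →
CosetRecursion (the same inside Galois-stable codimension-1 torsion cosets, by induction on
dimension) → SieveFiniteness. Nothing here is filed now.

KILL CRITERIA. (i) Refutation of SieveFiniteness (an infinite family of isolated Hodge characters of
one length and unbounded order) closes the route as a strategy (close --reason
refuted:SieveFiniteness): without compactness in the tower direction the sporadic list is not finite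
and the line is just 'HC for Fermat varieties'; the refuters' p = 2 censuses to m = 240 (1685
certified-isolated primitive orbits for m ≤ 150, 224 in 151..200, peaks 60:416 and 120:351, thin
tail) have not produced such a family. (ii) Refutation of CosetAlgebraicity or SporadicAlgebraicity
is a counterexample to the Hodge conjecture (route closes refuted:…, summit refuted). (iii) If the
indecomposable coset families of length 6 turn out to be exactly Shioda–Aoki-reachable characters
(nothing new on lines) AND every indecomposable isolated fourfold character is K3-sector, the route
is superseded by DerivedTorelliFermat (close --reason superseded). (iv) A second 'restates the
target' verdict against the indecomposable cut (an absorption trick that does not pass through a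
decomposable character) forces a pivot to the effective sieve alone. (v) Proved elsewhere:
PadicSemiregularLift.HodgeFermatVarieties / SupersingularIsotypicLift.FermatHodge moot FermatHC but
not the sieve theorem.

NOT DECOMPOSED YET. The line-type classification for indecomposable length ≥ 6 (layer 2 of
CosetAlgebraicity); the effective bound M₀(p) (card K2: constants compound along the recursion —
informal rank-5 item EffectiveSieveBound, not typed until a number is defensible; M₀(1) = 180, M₀(2)
≥ 240); the general abelian-tower version (card K3: Hodge-jump loci of unitary rank-one local
systems are rational polytopes × torsion-translated subtori, arXiv:math/0610382 Thm 1.3–1.4; IH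
version = Budur's open Question 1.6) — deliberately outside the sector; a weakening of
SieveFiniteness to indecomposable isolated characters (all the assembly needs) if the full statement
stalls; formalisation of Shioda's inductive structure on real carriers (BlockCancellation; shared
debt with DerivedTorelliFermat.ShiodaAokiSupply and the tree's Aoki1987_claim_juxtaposition
programme); the one-line Literature refactor that would let route files use fermatEigenspace again
(move IsRationalClass.map out of ComplexConjugation.lean and re-point the import of
DiagonalCharacterEigenspace.lean — filed as a definition request).

CHEAPEST FALSIFIER. DONE by refuters since open (items 13722 / 13234 evidence:
census-r6-isolated.txt, CENSUS_v2.md, fermat_fourfold_hodge_census_tail_151-240.txt,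
len4_isolated_census_m5-200.txt): the sieve's checkable shadows — 'prime level ⇒ paired' (a tree
theorem), the length-4 dichotomy (census m ≤ 360 = Shioda/Aoki's 101 exceptional orbits on 22 levels
≤ 180, nothing beyond) and the length-6 isolated census to m = 240 (no parametrised infinite
isolated family; tail thins after 120). NEXT cheapest (refuter, kit, hours): (a) re-run the length-6
census with the INDECOMPOSABLE filter (how many certified-isolated orbits are Shioda-decomposable,
e.g. the (a,a,b,b,c,c) doublings at m = 14, 18, 20?) — prediction: the indecomposable isolated list
is markedly shorter and still non-empty (da Silva's class); (b) search for an absorption of an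
indecomposable on-line character into a known supply NOT passing through a decomposable character —
finding one re-opens kill criterion (iv); (c) a count still growing at m = 420 (kit jobs
j004286–j004291 queued by refuters) retires SieveFiniteness for p = 2.

NUMBERS. Length 4 (surfaces): ρ(X²ₘ) = 3(m−1)(m−2) + 1 + δₘ + 48(m/2)* + 24(m/3)* + 24ε(m), ε(m)
supported on divisors d ≤ 180 with (d,6) ≠ 1 (Shioda 1982 via AokiShioda1983 (1.2), GouveaYui p.
92); standard indecomposables αᵢ = (i, d+i, m−2i, d), βᵢ = (i, d+i, d+2i, m−4i) (m = 2d), γⱼ = (j,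
d+j, 2d+j, m−3j) (m = 3d). Exact censuses (planner calc/l4check.py m ≤ 72; refuters to m = 360):
isolated primitive pair-free length-4 orbits = Aoki–Shioda's exceptional elements, 101 orbits on 22
levels {12, …, 180}, none in (180, 360]. Length 6 (fourfolds), refuter censuses with a SOUND
single-prime isolation certificate (no Hodge ℓ-division neighbour for one prime ℓ ∤ m ⇒
¬OnHodgeLine, by level inflation): certified-isolated primitive pair-free orbits at m = 14:1 18:3
20:5 21:2 24:20 28:5 30:75–76 33:1 36:31 39:2 40:15 42:136–137 45:4 (two independent refuter
censuses differ by one orbit at m = 30, 42) 48:37 50:2 54:17 56:12 60:416 63:3 66:27 70:4 72:60 …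
84:176, 90:76, 96:17, 102:6, 105:2, 108:8, 110:3, 112:3, 114:5, 120:351, 126:53, 132:25, 140:3,
150:2, 156:22, 160:2, 168:87, 180:100, 190:1, 192:2, 198:10, 210:40, 240:76 (the card's '3 | m only'
pattern is FALSE: its ℓ ∈ {5,7} run missed every level divisible by 5 or 7; the ⇐ direction of its
ℓ-division 'iff' is also false, e.g. (2,2,21,21,22,22)/30). Slab measure μ(P) = A(5,2)/5! = 0.55
(fourfolds), 2/3 (surfaces). Known HC degrees in dim 4: m prime, m ≤ 21, 27, prime powers (Aoki1987
Cor. 2-3), m ≤ 100 coprime to 6 claimed (arXiv:2101.04739 Thm 3.3); P₃₃ false (Prop. 3.6). M₀(1) =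
180 (AokiShioda1983); M₀(2) ≥ 240.

DEFINITION REQUESTS. FULFILLED since open: FermatCharacter.OnHodgeLine / IsIsolated / lineChar with
'paired ⇒ OnHodgeLine', unit/permutation/inflation invariance (Literature FermatHodgeLines.lean) and
FermatCharacter.IsDecomposable / IsHodgeMultiset (FermatShiodaCondition.lean) — the items now use
them by name. NEW (cone hygiene, filed with `ledger workitem add --kind definition`): a one-line
Literature refactor — move `IsRationalClass.map` (ComplexConjugation.lean l. 72, a 3-line
functoriality lemma) into RationalHodgeClasses.lean and replace `import …ComplexConjugation` in
DiagonalCharacterEigenspace.lean by it; this drops the 12 unproved Kähler/Hodge-decomposition facts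
from the import cone of FermatDiagonalAction and hence of every Fermat route (GaloisSieve could then
return to the `fermatEigenspace` spelling; DerivedTorelliFermat / DworkPrymHodge profit likewise).
Cite facts wanted: none new (Theorem (𝔅²ₘ) landed as AokiShioda1983_thmB2m_*).

Novelty: Searches (2026-08-15): lit search "Aoki simple factors Jacobian Fermat curve Picard number" / "Aoki
arithmetic problems Hodge cycles Fermat varieties" (searchd rc 75, service unavailable all session);
lit galaxy search "Hodge cycles on the Fermat varieties" --star all (0), "Picard number of a Fermat
surface" --star all (3: panama:514339513565269 Arithmetic and Geometry I = AokiShioda1983 READ pp.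
1–3,10; panama:341063352975363 GouveaYui READ p. 92–93, 152–154; LNM 1383), in-book searches of
both; lit read doi:10.1007/bf01458703 (only the 1984 erratum is held); ledger negatives --problem
HodgeConjecture (0); the 47 Theses of the sub by title/status + DerivedTorelliFermat, QbarEnvelope,
KatzUnwinding, DegreeSpectroscopy read; the card's own searches and its novelty audit r25 (zbMATH
Aoki 1983–2004, Ran, Shioda, Kubert, Das, Budur; Markman 2502.03415).
Nearest prior art found: AokiShioda1983 + Aoki1983 (Theorem (𝔅²ₘ): for length 4 the full dichotomy
'three one-parameter standard families + finitely many exceptional elements, all of level ≤ 180' —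
i.e. SieveFiniteness and the line classification at p = 1, proved by Aoki's character-sum case
analysis, not by equidistribution); Aoki1991 (simple CM factors of Fermat Jacobians / Picard numbers
of products of Fermat curves: the length-4 arithmetic in Jacobian language); Aoki1987 (standard
cycles = Hasse–Davenport lines); arXiv:2101.04739 (the m = 33 class); BombieriGubler2001 §4.3
(equidistribution of Galois orbits of torsion / small  [refs: 10.1007/bf01458703, 2101.04739, math/0610382, doi:10.1007/bf01458703, AokiShioda1983, Aoki1983, Aoki1991, Aoki1987, BombieriGubler2001]

Barriers (technique_class: unlikely-intersections, equidistribution, fermat-motives): - technique_class: unlikely-intersections, equidistribution, fermat-motives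
- Literature.Barriers.HodgeConjecture.Weil1977_exceptionalHodgeClasses: the targets are exceptional
classes (outside the ring generated by divisors/linear subspaces of Xⁿₘ); evaded because the sieve
LOCATES them (coset families vs isolated points) and the cycle engines are CM-isogeny
correspondences, Aoki–Shioda curves on auxiliary surfaces and individual complete intersections,
never cup products of divisors; Mumford1968_simpleFourfold_exceptionalHodgeClasses likewise.
- Literature.Barriers.HodgeConjecture.Andre1996_hodgeClassesOnAbelianVarieties_motivated: Fermat
motives are of CM abelian type (Shioda–Katsura), so every class here is motivated/absolute Hodge;
the route is positive-side only ('isolated' means outside uniform families, never non-algebraic) and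
never argues motivated ⇒ algebraic; a refutation inside the sector would also refute standard
conjecture B — recorded as the cost in Kill criteria. HodgeClassesAreAbsoluteFor: same remark.
- Literature.Barriers.HodgeConjecture.CattaniDeligneKaplan1995_hodgeLocus_algebraicFor: not used —
the parameter space is the real character torus of an abelian tower of unbounded rank, not the
complex base of one VHS; finiteness comes from arithmetic equidistribution, not from CDK/BKU.
- Literature.Barriers.HodgeConjecture.AtiyahHirzebruch1962_torsionClass_notAlgebraic: rational
coefficients throughout (ℂ-spans of cycle classes); torsion points index covers,

Novelty grade: variant — route-review grade (refuter rreview-0815T18-6; concurs with novelty audit r26 of the card): VARIANT. Same mechanism as the printed length-4 theory (Shioda 1982 conj. / Aoki 1983 / Aoki–Shioda 1983: three coset families + finitely many exceptional characters, effective bound 180; Koblitz–Rohrlich's F (refuter refuter-rreview-0815T18-6-0, 2026-08-15T19:21:55Z; prior: doi:10.1007/bf01458703 Aoki, Math. Ann. 266 (1983) + AokiShioda1983: Theorem (B^2_m) = SieveFiniteness + line classification at p=1, bound 180, Koblitz-Rohrlich 1978 / Aoki1991: split length-6 case via Fourier analysis over the Galois group (audit r26), BombieriGubler2001 §4.3 /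 Bilu 1997: equidistribution of Galois orbits of torsion points (the engine), arXiv:2101.04739 da Silva: the m=33 fourfol)

History (route lifecycle, newest last):
- 2026-08-15T20:17:35Z · rev 6: restated PairCancellation (stmt-HodgeConjecture-13235) — cone repair (rrepair-HodgeConjecture-GaloisSieve-b29e92cf): restate PairCancellation with the abbrev `fermatHypersurface n m` unfolded to `SmoothHypersurface.hy (planner-rrepair-HodgeConjecture-GaloisSieve-b29e92cf-0)
- 2026-08-15T20:19:16Z · rev 7: restated FermatSurfaceEigenlines (stmt-HodgeConjecture-13236) — cone repair (rrepair-HodgeConjecture-GaloisSieve-b29e92cf): restate FermatSurfaceEigenlines with the abbrev `fermatHypersurface n m` unfolded to `SmoothHypersur (planner-rrepair-HodgeConjecture-GaloisSieve-b29e92cf-0)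
- 2026-08-15T20:20:17Z · rev 8: restated EigenspaceInputs (stmt-HodgeConjecture-13237) — cone repair (rrepair-HodgeConjecture-GaloisSieve-b29e92cf): restate EigenspaceInputs with the abbrev `fermatHypersurface n m` unfolded to `SmoothHypersurface.hy (planner-rrepair-HodgeConjecture-GaloisSieve-b29e92cf-0)
- 2026-08-15T20:24:29Z · rev 10: restated EigenlineAssembly (stmt-HodgeConjecture-13713) — cone repair: restate EigenlineAssembly with hypotheses ordered HodgeEigenlines → HypersurfaceLefschetz → EigenspaceInputs (stmt-HodgeConjecture-13713 was render (planner-rrepair-HodgeConjecture-GaloisSieve-b29e92cf-0)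
- 2026-08-15T20:47:26Z · rev 11: dropped EigenlineAssembly — cone repair (rrepair-HodgeConjecture-GaloisSieve-b29e92cf): RE-ROUTE AROUND the passengers — route imports FermatHodgeConjectureAssembly + Sweep1 replaced by Fe (planner-rrepair-HodgeConjecture-GaloisSieve-b29e92cf-0)
- 2026-08-15T20:48:07Z · rev 12: restated Assembly (stmt-HodgeConjecture-13240) — cone repair: Assembly now lists EigenlineAssembly between HodgeModels and SectorComplement, matching the new deciding theorem (closable by one line: fun hC hS h (planner-rrepair-HodgeConjecture-GaloisSieve-b29e92cf-0)
- 2026-08-16T03:56:41Z · rev 14: restated EigenlineInduction (stmt-HodgeConjecture-14268), Assembly (stmt-HodgeConjecture-14566) — cone + cut + badge repair, completion (rbadge-HodgeConjecture-GaloisSieve-b29e92cf, 2026-08-16): the 03:31Z edit was REPORTED bounced ('at most 15 items, would (planner-rbadge-HodgeConjecture-GaloisSieve-b29e92cf-0)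
- 2026-08-26T05:43:26Z · DORMANT — reconciler: no traction for 8.4 d (last activity item-evidence-added at 2026-08-17T19:55:48Z); parked, not closed — `ledger route dormant route-HodgeConjecture- (operator:999:819860)

sub-problem: HodgeConjecture · status: dormant · opened planner-plancard-HodgeConjecture-HodgeConject-dbd15a05-0 2026-08-15T19:00:45Z · rev 15 · ledger route-HodgeConjecture-GaloisSieve
GENERATED by the gate from the ledger (D-0016/17). Provers cite these decls: `theorem foo : Summit.HodgeConjecture.HodgeConjecture.Theses.GaloisSieve.<Decl> := …` in Summits/HodgeConjecture/HodgeConjecture/Theorems/<Name>.lean.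
-/

namespace Summit.HodgeConjecture.HodgeConjecture.Theses.GaloisSieve

open scoped BigOperators Topology Manifold Classical MeasureTheory ProbabilityTheory Matrix InnerProductSpace ComplexConjugate ContinuousMap
open Filter Set Function TopologicalSpace MeasureTheory

attribute [summit_statement] _root_.HodgeConjecture

/-! Retired items kept as plain definitions (history; not obligations of this route): landed proofs / closed glue still name them. -/

/-- retired stmt-HodgeConjecture-1943 (replaced, gen None) — proved by Summit.HodgeConjecture.HodgeConjecture.Theorems.nodalSupport_hodgeModels_proof @ 6468568b8792. -/
def HodgeModels : Prop :=
  ∀ (n : ℕ) (X : Literature.AlgebraicGeometry.Motives.SchemeOver ℂ), Literature.AlgebraicGeometry.HodgeTheory.nonempty_hodgeModel n X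

-- earlier HodgeEigenlines (stmt-HodgeConjecture-13231, replaced 2026-08-15T19:53:04Z -> stmt-HodgeConjecture-13659): retired by None — ∀ (p m : ℕ) [NeZero m] (α : Fin (2 * p + 2) → ZMod m), 0 < p → Literature.AlgebraicGeometry.HodgeTheory.FermatCharacter.IsHodge α → Literature.AlgebraicGeometry.HodgeTheory.fermatEigenspace m α (2 * p) ≤ Literature.AlgebraicGeometry.HodgeTheory.algebraicClasses (Lite
-- earlier HodgeEigenlines (stmt-HodgeConjecture-13659, replaced 2026-08-16T03:31:53Z -> stmt-HodgeConjecture-14560): retired by None — ∀ (p m : ℕ) [NeZero m] (α : Fin (2 * p + 2) → ZMod m), 0 < p → Literature.AlgebraicGeometry.HodgeTheory.FermatCharacter.IsHodge α → Literature.AlgebraicGeometry.HodgeTheory.fermatEigenspace m α (2 * p) ≤ Literature.AlgebraicGeometry.HodgeTheory.algebraicClasses (Lite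
/-- item stmt-HodgeConjecture-14560 · target · rank 0 · open · by planner
why it might fail: Instance family of HC (every Fermat 2p-fold, every degree): one non-algebraic eigenline refutes it — first suspects da Silva's isolated m = 33 fourfold class (1,4,16,22,25,31) (arXiv:2101.04739 Prop. 3.6, Question 1) and Aoki's non-standard elements.
sources: Shioda1979HodgeFermat, Ran1980, Aoki1983, Aoki1987, arXiv:2101.04739
[target] For every p ≥ 1, every m ≥ 1 and every Hodge character α ∈ 𝔅²ᵖₘ (all aᵢ ≠ 0, Σaᵢ = 0,
Σ⟨taᵢ⟩ = m(p+1) for all units t), the eigenline V(α) ⊂ H²ᵖ(V₊(Σxᵢᵐ)(ℂ); ℂ) consists of algebraic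
classes of codimension p. CONE REPAIR 2026-08-16: V(α) is spelled INLINE over the light file
DiagonalSymmetry as the classes c with H(g_a) c = (∏ (a i : ℂ)^⟨αᵢ⟩) • c for every diagonal symmetry
a ∈ μₘ²ᵖ⁺² (g_a = diagonalMap), which is VERBATIM `c ∈ fermatEigenspace m α (2p)` by
mem_fermatEigenspace_iff (planner evidence Delta.lean, rc 0: New.HodgeEigenlines ↔
Old.HodgeEigenlines) — so the content is UNCHANGED from rev 12 (stmt-13659) and all audits transfer;
provers rewrite with the bridge lemma isEigInline_iff (Bridge.lean on this item) and work with
fermatEigenspace in Theorems/. Equivalent (given EigenspaceInputs) to HC for all Fermat 2p-folds.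
[difficulty: open-problem] -/
@[route_item "route-HodgeConjecture-GaloisSieve"]
def HodgeEigenlines : Prop :=
  open Literature.AlgebraicGeometry.Motives Literature.AlgebraicGeometry.HodgeTheory Literature.AlgebraicTopology.SingularHomology in ∀ (p m : ℕ) [NeZero m] (α : Fin (2 * p + 2) → ZMod m), 0 < p → FermatCharacter.IsHodge α → ∀ c : complexBetti (SmoothHypersurface.hypersurface (fermatPolynomial ℂ (2 * p) m)) (2 * p), (∀ (a : Fin (2 * p + 2) → ℂˣ) (ha : a ∈ diagonalStabilizer (fermatPolynomial ℂ (2 * p) m)), (∀ i, a i ^ m = 1) → singularCohomology.map ℂ ℂ (diagonalMap (fermatPolynomial ℂ (2 * p) m) ha) (2 * p) c = (∏ i, ((a i : ℂˣ) : ℂ) ^ (α i).val) • c) → c ∈ algebraicClasses (SmoothHypersurface.hypersurface (fermatPolynomial ℂ (2 * p) m)) p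

-- earlier CosetAlgebraicity (stmt-HodgeConjecture-13232, replaced 2026-08-15T20:13:39Z -> stmt-HodgeConjecture-13708): retired by None — ∀ (p m : ℕ) [NeZero m] (α : Fin (2 * p + 2) → ZMod m), 0 < p → Literature.AlgebraicGeometry.HodgeTheory.FermatCharacter.IsHodge α → (∀ i j, i ≠ j → α i + α j ≠ 0) → (∃ v : Fin (2 * p + 2) → ℤ, v ≠ 0 ∧ ∑ i, v i = 0 ∧ ∀ N : ℕ, 0 < N → Nat.Coprime N m → ∀ k : ℤ, Liter
-- earlier CosetAlgebraicity (stmt-HodgeConjecture-13708, replaced 2026-08-16T03:31:53Z -> stmt-HodgeConjecture-14561): retired by None — ∀ (p m : ℕ) [NeZero m] (α : Fin (2 * p + 2) → ZMod m), 0 < p → Literature.AlgebraicGeometry.HodgeTheory.FermatCharacter.IsHodge α → (∀ i j, i ≠ j → α i + α j ≠ 0) → (∃ v : Fin (2 * p + 2) → ℤ, v ≠ 0 ∧ ∑ i, v i = 0 ∧ ∀ N : ℕ, 0 < N → Nat.Coprime N m → ∀ k : ℤ, Liter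
/-- item stmt-HodgeConjecture-14561 · crux · rank 2 · open · by planner
why it might fail: HC for infinitely many eigenlines at once, open for p ≥ 2: indecomposable Hodge lines of length ≥ 6 are unclassified (e.g. (1,1,7,14,15,16)/18) and Aoki's standard-cycle supply covers block directions only; one uncovered line type is open HC.
sources: Aoki1987, AokiShioda1983, Aoki1991, Shioda1979HodgeFermat, arXiv:2101.04739, Aoki2000FermatTypeHC
[crux] (card K1, COSET ALGEBRAICITY — REPAIRED CUT 2026-08-16) For every p ≥ 2, m ≥ 1 and every
INDECOMPOSABLE Hodge character α of length 2p+2 (its value multiset does not split into two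
non-empty Hodge multisets — Shioda1979PJA §1 Def. (i), tree FermatCharacter.IsDecomposable;
indecomposable ⇒ pair-free, Delta.lean indecomposable_pairFree; for length 6 the two notions
coincide) lying ON A HODGE LINE (tree FermatCharacter.OnHodgeLine, Iff.rfl to the old inline
∃v-clause) the eigenline V(α) (inline spelling, = fermatEigenspace m α (2p)) of the Fermat 2p-fold
of degree m is algebraic. This is the refuters' repair C′ of the rev-12 item
(rattack-12508/13876/13851: with the PAIR-FREE cut, a frozen Hodge block c beside a moving standard
block σ_{3,y} gave a typed Hodge line through the DECOMPOSABLE character c ∗ σ_{3,y}, so the old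
crux absorbed claim(c) for every pair-free c via Aoki1987 Thm 1-4 — it restated the target;
decomposable characters now go to the known support BlockCancellation and the witness misses C′).
Old.CosetAlgebraicity → New.CosetAlgebraicity (Delta.lean), so every 'survives / non-vacuous' audit
transfers; non-vacuous at p = 2: the genuine length-6 line through (1,1 -/
@[route_item "route-HodgeConjecture-GaloisSieve", crux]
def CosetAlgebraicity : Prop :=
  open Literature.AlgebraicGeometry.Motives Literature.AlgebraicGeometry.HodgeTheory Literature.AlgebraicTopology.SingularHomology in ∀ (p m : ℕ) [NeZero m] (α : Fin (2 * p + 2) → ZMod m), 2 ≤ p → FermatCharacter.IsHodge α → ¬ FermatCharacter.IsDecomposable (Finset.univ.val.map α) → FermatCharacter.OnHodgeLine α → ∀ c : complexBetti (SmoothHypersurface.hypersurface (fermatPolynomial ℂ (2 * p) m)) (2 * p), (∀ (a : Fin (2 * p + 2) → ℂˣ) (ha : a ∈ diagonalStabilizer (fermatPolynomial ℂ (2 * p) m)), (∀ i, a i ^ m = 1) → singularCohomology.map ℂ ℂ (diagonalMap (fermatPolynomial ℂ (2 * p) m) ha) (2 * p) c = (∏ i, ((a i : ℂˣ) : ℂ)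 ^ (α i).val) • c) → c ∈ algebraicClasses (SmoothHypersurface.hypersurface (fermatPolynomial ℂ (2 * p) m)) p

-- earlier SporadicAlgebraicity (stmt-HodgeConjecture-13233, replaced 2026-08-15T20:15:33Z -> stmt-HodgeConjecture-13722): retired by None — ∀ (p m : ℕ) [NeZero m] (α : Fin (2 * p + 2) → ZMod m), 0 < p → Literature.AlgebraicGeometry.HodgeTheory.FermatCharacter.IsHodge α → ¬ (∃ v : Fin (2 * p + 2) → ℤ, v ≠ 0 ∧ ∑ i, v i = 0 ∧ ∀ N : ℕ, 0 < N → Nat.Coprime N m → ∀ k : ℤ, Literature.AlgebraicGeometry.Hodg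
-- earlier SporadicAlgebraicity (stmt-HodgeConjecture-13722, replaced 2026-08-16T03:31:53Z -> stmt-HodgeConjecture-14562): retired by None — ∀ (p m : ℕ) [NeZero m] (α : Fin (2 * p + 2) → ZMod m), 0 < p → Literature.AlgebraicGeometry.HodgeTheory.FermatCharacter.IsHodge α → ¬ (∃ v : Fin (2 * p + 2) → ℤ, v ≠ 0 ∧ ∑ i, v i = 0 ∧ ∀ N : ℕ, 0 < N → Nat.Coprime N m → ∀ k : ℤ, Literature.AlgebraicGeometry.Hodg
/-- item stmt-HodgeConjecture-14562 · crux · rank 3 · open · by planner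
why it might fail: Each indecomposable isolated class needs its own cycle; the first, da Silva's (1,4,16,22,25,31)/33 (certified isolated, outside P_33 and Aoki's supply, arXiv:2101.04739 Question 1), is open; p = 2 certified-isolated counts reach 416 at m = 60; one non-algebraic entry kills HC.
sources: arXiv:2101.04739, Aoki1987, Aoki1983, AljovinMovasatiVillaflor2019, Shioda1979HodgeFermat
[crux] (card K4, SPORADIC LIST — REPAIRED CUT 2026-08-16) For every p ≥ 2, m ≥ 1 and every
INDECOMPOSABLE (¬ FermatCharacter.IsDecomposable) ISOLATED (¬ FermatCharacter.OnHodgeLine) Hodge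
character α of length 2p+2, the eigenline V(α) (inline spelling, = fermatEigenspace m α (2p)) is
algebraic. By SieveFiniteness this is, for each p, a statement about finitely many torsion points;
first open entry da Silva's (1,4,16,22,25,31)/33 (Hodge by `decide`, pair-free hence indecomposable,
certified isolated: no Hodge 5- or 7-division neighbour — refuter evidence on stmt-13722; =
arXiv:2101.04739 Prop. 3.6 / Question 1, outside Shioda's P₃₃ and Aoki's supply). Refuter censuses
(sound single-prime certificate): certified-isolated primitive pair-free length-6 orbits at m = 14:1
18:3 20:5 21:2 24:20 28:5 30:75–76 33:1 36:31 39:2 40:15 42:136–137 45:4 48:37 50:2 54:17 56:12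
60:416 … 120:351 168:87 180:100 210:40 240:76, thin tail after 120 — each entry needs an individual
cycle (Newton-identity complete intersections, K3 correspondences, Villaflor periods).
Old.SporadicAlgebraicity → New.SporadicAlgebraicity (Delta.lean): audits transfer. [deps:
SieveFiniteness] [difficulty: XL] -/
@[route_item "route-HodgeConjecture-GaloisSieve", crux]
def SporadicAlgebraicity : Prop :=
  open Literature.AlgebraicGeometry.Motives Literature.AlgebraicGeometry.HodgeTheory Literature.AlgebraicTopology.SingularHomology in ∀ (p m : ℕ) [NeZero m] (α : Fin (2 * p + 2) → ZMod m), 2 ≤ p → FermatCharacter.IsHodge α → ¬ FermatCharacter.IsDecomposable (Finset.univ.val.map α) → ¬ FermatCharacter.OnHodgeLine α → ∀ c : complexBetti (SmoothHypersurface.hypersurface (fermatPolynomial ℂ (2 * p) m)) (2 * p), (∀ (a : Fin (2 * p + 2) → ℂˣ) (ha : a ∈ diagonalStabilizer (fermatPolynomial ℂ (2 * p) m)), (∀ i, a i ^ m = 1) → singularCohomology.map ℂ ℂ (diagonalMap (fermatPolynomial ℂ (2 * p) m) ha) (2 * p) c = (∏ i, ((a i : ℂˣ) : ℂ) ^ (α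 i).val) • c) → c ∈ algebraicClasses (SmoothHypersurface.hypersurface (fermatPolynomial ℂ (2 * p) m)) p

/-- item stmt-HodgeConjecture-13234 · crux · rank 4 · open · by planner
why it might fail: In print only for length 4 (Theorem (B^2_m): exceptional elements only for m ≤ 180); the equidistribution recursion in Galois-stable sub-cosets is unwritten; p = 2 certified-isolated counts peak at 60:416 and 120:351; an infinite isolated family kills it.
sources: Aoki1983, AokiShioda1983, arXiv:2101.04739, KuipersNiederreiter1974, BombieriGubler2001, KoblitzOgus1979
[crux] (card P1, the SIEVE THEOREM, Fermat form) For every p ≥ 1 there is M₀(p) such that every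
isolated Hodge character α of length 2p+2, of any level m, has additive order ≤ M₀(p) in (ℤ/m)²ᵖ⁺² —
i.e. isolated Hodge characters are finitely many torsion points of the character torus. Mechanism:
Weyl criterion on the torus with Ramanujan-sum bounds for Galois orbits (a Hodge character of large
order is nearly annihilated by a frequency of bounded size, since the complement of the slab has
non-empty interior), recursion inside the finitely many Galois-stable codimension-1 torsion cosets,
leaves = cosets on which the slab is dense (every admissible torsion point there is Hodge, hence on
a Hodge line) or points. Depth 1 (m prime ⇒ paired) is Ran–Shioda / Koblitz–Ogus, PROVED in the tree
(FermatCharacter.IsHodge.isPaired); p = 1 is Theorem (𝔅²ₘ) of Shioda 1982 / Aoki1983 with M₀(1) =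
180. [difficulty: M] -/
@[route_item "route-HodgeConjecture-GaloisSieve"]
def SieveFiniteness : Prop :=
  ∀ p : ℕ, 0 < p → ∃ M₀ : ℕ, ∀ (m : ℕ) [NeZero m] (α : Fin (2 * p + 2) → ZMod m), Literature.AlgebraicGeometry.HodgeTheory.FermatCharacter.IsHodge α → ¬ (∃ v : Fin (2 * p + 2) → ℤ, v ≠ 0 ∧ ∑ i, v i = 0 ∧ ∀ N : ℕ, 0 < N → Nat.Coprime N m → ∀ k : ℤ, Literature.AlgebraicGeometry.HodgeTheory.FermatCharacter.IsHodge (fun i => (((N : ℤ) * ((α i).val : ℤ) + (m : ℤ) * k * v i : ℤ) : ZMod (m * N)))) → addOrderOf α ≤ M₀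

-- item stmt-HodgeConjecture-14475 · support · rank 5 · open · by planner — informal only, no Lean statement yet:
--   [crux] EFFECTIVE SIEVE BOUND (card K2; layer-2 parent of SporadicAlgebraicity): an explicit function
--   M₀(p) such that every isolated Hodge character of length 2p+2 (not on any Hodge line, as in
--   SieveFiniteness) has additive order ≤ M₀(p) — making the sporadic list a finite certified
--   computation. Known: M₀(1) = 180 (Shioda 1982 / Aoki1983 / AokiShioda1983, Theorem (B²ₘ): exceptional
--   length-4 elements exist only for m ≤ 180). For p = 2 the card's certified census gives isolated
--   orbits at m = 18,24,33,36,39,48,54 (≤ 54 searched), so M₀(2) ≥ 54. Route to a number: explicit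
--   Erdős–Turán–Koksma discre

/-- item stmt-HodgeConjecture-11281 · support · rank 9 · closed · proved by Summit.HodgeConjecture.HodgeConjecture.Theorems.derivedTorelliFermat_hypersurfaceLefschetz_proof @ f279bb5ba6f4 (prover) · by planner
sources: VoisinHodgeII2003
[support] (known theorem; cone hygiene) Lefschetz off the middle degree for smooth hypersurfaces Y ⊂
ℙⁿ⁺¹_ℂ: for 0 < p < n, 2p ≠ n, algebraicClasses Y p = ⊤ (VoisinHodgeII2003 Cor. 1.24–1.25: Lefschetz
hyperplane theorem + hard Lefschetz). This is VERBATIM the body of the tree's named fact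
Literature.AlgebraicGeometry.HodgeTheory.Voisin2003_smoothHypersurface_algebraicClasses_eq_top
(Iff.rfl), restated inline because that fact is currently cite_only: it closes by `fun n d Y hY p h0
hn h2 => Voisin2003_… hY p h0 hn h2` the moment the fact is READ-verified / vendored, or by a direct
proof. Sources: VoisinHodgeII2003. -/
@[route_item "route-HodgeConjecture-GaloisSieve", crux]
def HypersurfaceLefschetz : Prop :=
  ∀ ⦃n d : ℕ⦄ ⦃Y : Literature.AlgebraicGeometry.Motives.SchemeOver ℂ⦄, Literature.AlgebraicGeometry.Motives.IsSmoothHypersurface n d Y → ∀ p : ℕ, 0 < p → p < n → 2 * p ≠ n → Literature.AlgebraicGeometry.HodgeTheory.algebraicClasses Y p = ⊤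

-- `HypersurfaceLefschetz` holds: proved by `Summit.HodgeConjecture.HodgeConjecture.Theorems.derivedTorelliFermat_hypersurfaceLefschetz_proof` @ f279bb5ba6f4 (its module imports this route file, so no `_holds` link can be stated here).

/-- item stmt-HodgeConjecture-13238 · support · rank 9 · open · by planner
sources: Shioda1979PJA, Shioda1979HodgeFermat, Ran1980, Aoki1987, arXiv:2101.04739
[support] (the SECTOR STATEMENT, milestone; proved in glue.lean from the items above) the Hodge
conjecture for every smooth projective Fermat variety Xⁿₘ ⊂ ℙⁿ⁺¹_ℂ, every dimension n and every
degree m ≥ 1 (known: m prime, m ≤ 20 (Shioda1979PJA), m = 21, 27, prime powers and further degrees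
of Aoki1987; open from m = 33 on in dimension 4). [difficulty: XL] -/
@[route_item "route-HodgeConjecture-GaloisSieve"]
def FermatHC : Prop :=
  ∀ (n m : ℕ) (X : Literature.AlgebraicGeometry.Motives.SchemeOver ℂ), 0 < m → Literature.AlgebraicGeometry.Motives.IsFermatVariety n m X → Literature.AlgebraicGeometry.Motives.IsSmoothProjective n X → Literature.AlgebraicGeometry.HodgeTheory.HodgeConjectureFor n X

/-- item stmt-HodgeConjecture-13239 · support · rank 9 · open · by planner
sources: Deligne2000
[support] (bookkeeping, NOT claimed; declared sector frame, D-0027 §2.1) the complement of the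
route's sector: HC for all Fermat varieties implies HC. It exists so that the deciding theorem
concludes the sub-problem Statement by name; nobody is asked to prove it and graders should judge
the route on CosetAlgebraicity / SporadicAlgebraicity / SieveFiniteness. [difficulty: open-problem] -/
@[route_item "route-HodgeConjecture-GaloisSieve", crux]
def SectorComplement : Prop :=
  FermatHC → _root_.HodgeConjecture

-- earlier FermatSurfaceEigenlines (stmt-HodgeConjecture-13236, replaced 2026-08-15T20:19:16Z -> stmt-HodgeConjecture-13730): retired by None — ∀ (m : ℕ) [NeZero m] (α : Fin (2 * 1 + 2) → ZMod m), Literature.AlgebraicGeometry.HodgeTheory.FermatCharacter.IsHodge α → Literature.AlgebraicGeometry.HodgeTheory.fermatEigenspace m α (2 * 1) ≤ Literature.AlgebraicGeometry.HodgeTheory.algebraicClasses (Litera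
-- earlier FermatSurfaceEigenlines (stmt-HodgeConjecture-13730, replaced 2026-08-16T03:31:53Z -> stmt-HodgeConjecture-14563): retired by None — ∀ (m : ℕ) [NeZero m] (α : Fin (2 * 1 + 2) → ZMod m), Literature.AlgebraicGeometry.HodgeTheory.FermatCharacter.IsHodge α → Literature.AlgebraicGeometry.HodgeTheory.fermatEigenspace m α (2 * 1) ≤ Literature.AlgebraicGeometry.HodgeTheory.algebraicClasses (Litera
/-- item stmt-HodgeConjecture-14563 · support · rank 9 · closed · proved by Summit.HodgeConjecture.HodgeConjecture.Theorems.galoisSieve_fermatSurfaceEigenlines_proof @ 4f884bc826dc (prover) · by planner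
sources: AokiShioda1983, VoisinHodgeI2002, Shioda1979HodgeFermat
[support] (KNOWN: Lefschetz (1,1); base p = 1 of the induction; = the LANDED tree fact
AokiShioda1983_eigenline_le_neronSeveri, p63379, after the bridge rewrite) every Hodge eigenline
V(α), α ∈ 𝔅²ₘ of length 4, of the Fermat surface of degree m consists of algebraic classes (NS(X²ₘ)
⊗ ℂ = V(0) ⊕ ⨁ V(α), AokiShioda1983 (2.1)). CONE REPAIR 2026-08-16: eigenline spelled inline over
DiagonalSymmetry; New ↔ Old proved in Delta.lean (content unchanged from stmt-13730). [difficulty: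
provable-now] -/
@[route_item "route-HodgeConjecture-GaloisSieve", crux]
def FermatSurfaceEigenlines : Prop :=
  open Literature.AlgebraicGeometry.Motives Literature.AlgebraicGeometry.HodgeTheory Literature.AlgebraicTopology.SingularHomology in ∀ (m : ℕ) [NeZero m] (α : Fin (2 * 1 + 2) → ZMod m), FermatCharacter.IsHodge α → ∀ c : complexBetti (SmoothHypersurface.hypersurface (fermatPolynomial ℂ (2 * 1) m)) (2 * 1), (∀ (a : Fin (2 * 1 + 2) → ℂˣ) (ha : a ∈ diagonalStabilizer (fermatPolynomial ℂ (2 * 1) m)), (∀ i, a i ^ m = 1) → singularCohomology.map ℂ ℂ (diagonalMap (fermatPolynomial ℂ (2 * 1) m) ha) (2 * 1) c = (∏ i, ((a i : ℂˣ) : ℂ) ^ (α i).val) • c) → c ∈ algebraicClasses (SmoothHypersurface.hypersurface (fermatPolynomial ℂ (2 * 1) m)) 1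

-- `FermatSurfaceEigenlines` holds: proved by `Summit.HodgeConjecture.HodgeConjecture.Theorems.galoisSieve_fermatSurfaceEigenlines_proof` @ 4f884bc826dc (its module imports this route file, so no `_holds` link can be stated here).

-- earlier EigenspaceInputs (stmt-HodgeConjecture-13237, replaced 2026-08-15T20:20:17Z -> stmt-HodgeConjecture-13732): retired by None — ∀ (p m : ℕ) [NeZero m], 0 < p → (∀ α : Fin (2 * p + 2) → ZMod m, α ≠ 0 → (∃ i, α i = 0) → Literature.AlgebraicGeometry.HodgeTheory.fermatEigenspace m α (2 * p) = ⊥) ∧ (Literature.AlgebraicGeometry.HodgeTheory.fermatEigenspace m (0 : Fin (2 * p + 2) → ZMod m) (2 * p)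
-- earlier EigenspaceInputs (stmt-HodgeConjecture-13732, replaced 2026-08-16T03:31:53Z -> stmt-HodgeConjecture-14564): retired by None — ∀ (p m : ℕ) [NeZero m], 0 < p → (∀ α : Fin (2 * p + 2) → ZMod m, α ≠ 0 → (∃ i, α i = 0) → Literature.AlgebraicGeometry.HodgeTheory.fermatEigenspace m α (2 * p) = ⊥) ∧ (Literature.AlgebraicGeometry.HodgeTheory.fermatEigenspace m (0 : Fin (2 * p + 2) → ZMod m) (2 * p)
/-- item stmt-HodgeConjecture-14564 · support · rank 9 · open · by planner
sources: Ran1980, Shioda1979HodgeFermat, Shioda1979PJA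
[support] (KNOWN; Ran1980 Prop. 1.7 (i)–(ii), Shioda1979HodgeFermat (1.7), Hⁿ(Xⁿₘ)^G = Hⁿ(ℙⁿ)) the
three hypotheses hE2, hE0, hE4 of the tree theorem mem_algebraicClasses_fermat_middle_of_eigenspaces
for all p ≥ 1, m ≥ 1: V(α) = 0 for α ≠ 0 with a zero coordinate; V(0) lies in the image of
H²ᵖ(ℙ²ᵖ⁺¹); a character with all coordinates non-zero whose eigenspace carries a non-zero (p,p)
class has 2Σ⟨βᵢ⟩ = m(2p+2). CONE REPAIR 2026-08-16: the three eigenspaces spelled inline over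
DiagonalSymmetry; New ↔ Old proved in Delta.lean (content unchanged from stmt-13732). [difficulty:
L] -/
@[route_item "route-HodgeConjecture-GaloisSieve", crux]
def EigenspaceInputs : Prop :=
  open Literature.AlgebraicGeometry.Motives Literature.AlgebraicGeometry.HodgeTheory Literature.AlgebraicTopology.SingularHomology in ∀ (p m : ℕ) [NeZero m], 0 < p → (∀ α : Fin (2 * p + 2) → ZMod m, α ≠ 0 → (∃ i, α i = 0) → ∀ c : complexBetti (SmoothHypersurface.hypersurface (fermatPolynomial ℂ (2 * p) m)) (2 * p), (∀ (a : Fin (2 * p + 2) → ℂˣ) (ha : a ∈ diagonalStabilizer (fermatPolynomial ℂ (2 * p) m)), (∀ i, a i ^ m = 1) → singularCohomology.map ℂ ℂ (diagonalMap (fermatPolynomial ℂ (2 * p) m) ha) (2 * p) c = (∏ i, ((a i : ℂˣ) : ℂ) ^ (α i).val) • c) → c = 0) ∧ (∀ c : complexBetti (SmoothHypersurface.hypersurface (fermatPolynomial ℂ (2 * p) m)) (2 * p), (∀ (a : Fin (2 * p + 2) → ℂˣ) (ha : a ∈ diagonalStabilizer (fermatPolynomial ℂ (2 * p) m)), (∀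 i, a i ^ m = 1) → singularCohomology.map ℂ ℂ (diagonalMap (fermatPolynomial ℂ (2 * p) m) ha) (2 * p) c = (∏ i, ((a i : ℂˣ) : ℂ) ^ ((0 : Fin (2 * p + 2) → ZMod m) i).val) • c) → c ∈ LinearMap.range (complexBetti.map (SmoothHypersurface.hypersurfaceι (fermatPolynomial ℂ (2 * p) m)) (2 * p)).hom) ∧ (∀ (A : HodgeModel (2 * p) (SmoothHypersurface.hypersurface (fermatPolynomial ℂ (2 * p) m))) (β : Fin (2 * p + 2) → ZMod m), (∀ i, β i ≠ 0) → (∃ x : complexBetti (SmoothHypersurface.hypersurface (fermatPolynomial ℂ (2 * p) m)) (2 * p), (∀ (a : Fin (2 * p + 2) → ℂˣ) (ha : a ∈ diagonalStabilizer (fermatPolynomial ℂ (2 * p) m)), (∀ i, a i ^ m = 1) → singularCohomology.map ℂ ℂ (diagonalMap (fermatPolynomial ℂ (2 * p) m) ha) (2 * p) x = (∏ i, ((a i : ℂˣ) : ℂ) ^ (β i).val) • x) ∧ x ≠ 0 ∧ A.pullback (2 * p) x ∈ A.hodgePQ (2 * p) p p) → 2 * FermatCharacter.normSum β = m * (2 *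 p + 2))

-- earlier EigenlineAssembly (stmt-HodgeConjecture-13713, replaced 2026-08-15T20:24:29Z -> stmt-HodgeConjecture-13726): retired by None — HodgeEigenlines → EigenspaceInputs → HypersurfaceLefschetz → ∀ (n m : ℕ) (X : Literature.AlgebraicGeometry.Motives.SchemeOver ℂ), 0 < m → Literature.AlgebraicGeometry.Motives.IsFermatVariety n m X → Literature.AlgebraicGeometry.Motives.IsSmoothProjective n X → ∀ (p
-- earlier EigenlineAssembly (stmt-HodgeConjecture-13965, replaced 2026-08-16T03:31:53Z -> stmt-HodgeConjecture-14565): retired by None — HodgeEigenlines → (∀ ⦃n d : ℕ⦄ ⦃Y : Literature.AlgebraicGeometry.Motives.SchemeOver ℂ⦄, Literature.AlgebraicGeometry.Motives.IsSmoothHypersurface n d Y → ∀ p : ℕ, 0 < p → p < n → 2 * p ≠ n → Literature.AlgebraicGeometry.HodgeTheory.algebraicClasses Y p = ⊤) → (∀ (p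
/-- item stmt-HodgeConjecture-14565 · support · rank 9 · closed · proved by Summit.HodgeConjecture.HodgeConjecture.Theorems.galoisSieve_eigenlineAssembly_proof @ 8a496726cac9 (prover) · by planner
sources: Shioda1979PJA, Ran1980, Hartshorne1977, SerreGAGA1956
[support] (PROVABLE NOW — candidate proof attached on the retired stmt-13965, to be re-run after one
`rw [isEigInline_iff]`; the bodies of HypersurfaceLefschetz and EigenspaceInputs are INLINED
verbatim as hypotheses 2 and 3 so that this support names no other support) If every Hodge eigenline
of every Fermat 2p-fold is algebraic (HodgeEigenlines), Lefschetz holds off the middle degree and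
the eigenspace inputs hold, then every rational (p,p)-class on every smooth projective Fermat
variety Xⁿₘ (m ≥ 1, any n) is algebraic — the algebraicity conjunct of HodgeConjectureFor on the
whole sector. Proof: codimension 0 by algebraicClasses_zero; off the middle degree by
algebraicClasses_fermat_eq_top_of_two_mul_ne; middle degree by transport to V₊(Σxᵢᵐ) along
IsFermatVariety.isoFermatHypersurface (IsOfHodgeType.map_of_iso, IsRationalClass.map,
mem_algebraicClasses_map_of_iso) and mem_algebraicClasses_fermat_middle_of_eigenspaces — heavy
imports live in Theorems/, not in the route file. [deps: HodgeEigenlines, EigenspaceInputs,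
HypersurfaceLefschetz] [difficulty: provable-now] -/
@[route_item "route-HodgeConjecture-GaloisSieve", crux]
def EigenlineAssembly : Prop :=
  open Literature.AlgebraicGeometry.Motives Literature.AlgebraicGeometry.HodgeTheory Literature.AlgebraicTopology.SingularHomology in HodgeEigenlines → (∀ ⦃n d : ℕ⦄ ⦃Y : SchemeOver ℂ⦄, IsSmoothHypersurface n d Y → ∀ p : ℕ, 0 < p → p < n → 2 * p ≠ n → algebraicClasses Y p = ⊤) → (∀ (p m : ℕ) [NeZero m], 0 < p → (∀ α : Fin (2 * p + 2) → ZMod m, α ≠ 0 → (∃ i, α i = 0) → ∀ c : complexBetti (SmoothHypersurface.hypersurface (fermatPolynomial ℂ (2 * p) m)) (2 * p), (∀ (a : Fin (2 * p + 2) → ℂˣ) (ha : a ∈ diagonalStabilizer (fermatPolynomial ℂ (2 * p) m)), (∀ i, a i ^ m = 1) → singularCohomology.map ℂ ℂ (diagonalMap (fermatPolynomial ℂ (2 * p) m) ha) (2 * p) c = (∏ i, ((a i : ℂˣ) : ℂ) ^ (α i).val) • c) → c = 0) ∧ (∀ c : complexBetti (SmoothHypersurface.hypersurface (fermatPolynomial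 ℂ (2 * p) m)) (2 * p), (∀ (a : Fin (2 * p + 2) → ℂˣ) (ha : a ∈ diagonalStabilizer (fermatPolynomial ℂ (2 * p) m)), (∀ i, a i ^ m = 1) → singularCohomology.map ℂ ℂ (diagonalMap (fermatPolynomial ℂ (2 * p) m) ha) (2 * p) c = (∏ i, ((a i : ℂˣ) : ℂ) ^ ((0 : Fin (2 * p + 2) → ZMod m) i).val) • c) → c ∈ LinearMap.range (complexBetti.map (SmoothHypersurface.hypersurfaceι (fermatPolynomial ℂ (2 * p) m)) (2 * p)).hom) ∧ (∀ (A : HodgeModel (2 * p) (SmoothHypersurface.hypersurface (fermatPolynomial ℂ (2 * p) m))) (β : Fin (2 * p + 2) → ZMod m), (∀ i, β i ≠ 0) → (∃ x : complexBetti (SmoothHypersurface.hypersurface (fermatPolynomial ℂ (2 * p) m)) (2 * p), (∀ (a : Fin (2 * p + 2) → ℂˣ) (ha : a ∈ diagonalStabilizer (fermatPolynomial ℂ (2 * p) m)), (∀ i, a i ^ m = 1) → singularCohomology.map ℂ ℂ (diagonalMap (fermatPolynomial ℂ (2 * p) m) ha) (2 * p) x = (∏ i, ((a i : ℂˣ)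 : ℂ) ^ (β i).val) • x) ∧ x ≠ 0 ∧ A.pullback (2 * p) x ∈ A.hodgePQ (2 * p) p p) → 2 * FermatCharacter.normSum β = m * (2 * p + 2))) → ∀ (n m : ℕ) (X : SchemeOver ℂ), 0 < m → IsFermatVariety n m X → IsSmoothProjective n X → ∀ (p : ℕ) (c : singularCohomology ℂ ℂ (ComplexPoints X) (2 * p)), IsRationalClass c → IsOfHodgeType n X (2 * p) p p c → c ∈ algebraicClasses X p

-- `EigenlineAssembly` holds: proved by `Summit.HodgeConjecture.HodgeConjecture.Theorems.galoisSieve_eigenlineAssembly_proof` @ 8a496726cac9 (its module imports this route file, so no `_holds` link can be stated here).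

/-- item stmt-HodgeConjecture-14567 · support · rank 9 · open · by planner
sources: Shioda1979HodgeFermat, Shioda1979PJA, Aoki1987, arXiv:2101.04739, Ran1980
[support] (KNOWN — Shioda's inductive structure, Shioda1979HodgeFermat Thm I–II (type II, blow-up of
the degree-m rational map X^{r}ₘ × X^{s}ₘ ⇢ X^{r+s}ₘ with centre X^{r−1}ₘ × X^{s−1}ₘ) / Aoki1987 Thm
1-4 (i) 'claim(β) ∧ claim(γ) ⇒ claim(β ∗ γ)' / arXiv:2101.04739 Thm 2.2–Cor 2.3; replaces
PairCancellation, which is its q = 0 case; formalisation debt on the tree's carriers, cf. the tree's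
Aoki1987_claim_juxtaposition programme) For p ≥ 1 and m ≥ 1: if every Hodge eigenline of the Fermat
2q-fold of degree m is algebraic for all 0 < q < p, then V(α) is algebraic on the Fermat 2p-fold for
every DECOMPOSABLE Hodge character α of length 2p+2 (value multiset = t + u with t, u non-empty
Hodge multisets, Shioda1979PJA §1 Def. (i), tree FermatCharacter.IsDecomposable): up to a
permutation α = β ∗ γ with β, γ Hodge of lengths 2q+2, 2(p−1−q)+2, and V(β ∗ γ) is the image of V(β)
⊗ V(γ) under the algebraic correspondence carried by the blow-up centre (Tate-twisted Künneth
summand); blocks of length 2 (pairs (a, −a), q = 0 or q = p−1) contribute classes of linear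
subspaces (Ran1980 Thm 4.9 / tree Shioda_claim_paired). Eigenlines spelled inline (=
fermatEigenspace, bridge isEigInline_iff). [diff -/
@[route_item "route-HodgeConjecture-GaloisSieve", crux]
def BlockCancellation : Prop :=
  open Literature.AlgebraicGeometry.Motives Literature.AlgebraicGeometry.HodgeTheory Literature.AlgebraicTopology.SingularHomology in ∀ (p m : ℕ) [NeZero m], 0 < p → (∀ q : ℕ, 0 < q → q < p → ∀ β : Fin (2 * q + 2) → ZMod m, FermatCharacter.IsHodge β → ∀ c : complexBetti (SmoothHypersurface.hypersurface (fermatPolynomial ℂ (2 * q) m)) (2 * q), (∀ (a : Fin (2 * q + 2) → ℂˣ) (ha : a ∈ diagonalStabilizer (fermatPolynomial ℂ (2 * q) m)), (∀ i, a i ^ m = 1) → singularCohomology.map ℂ ℂ (diagonalMap (fermatPolynomial ℂ (2 * q) m) ha) (2 * q) c = (∏ i, ((a i : ℂˣ) : ℂ) ^ (β i).val) • c) → c ∈ algebraicClasses (SmoothHypersurface.hypersurface (fermatPolynomial ℂ (2 * q) m)) q) → ∀ α : Fin (2 * p + 2) → ZMod m, FermatCharacter.IsHodge α → FermatCharacter.IsDecomposable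 (Finset.univ.val.map α) → ∀ c : complexBetti (SmoothHypersurface.hypersurface (fermatPolynomial ℂ (2 * p) m)) (2 * p), (∀ (a : Fin (2 * p + 2) → ℂˣ) (ha : a ∈ diagonalStabilizer (fermatPolynomial ℂ (2 * p) m)), (∀ i, a i ^ m = 1) → singularCohomology.map ℂ ℂ (diagonalMap (fermatPolynomial ℂ (2 * p) m) ha) (2 * p) c = (∏ i, ((a i : ℂˣ) : ℂ) ^ (α i).val) • c) → c ∈ algebraicClasses (SmoothHypersurface.hypersurface (fermatPolynomial ℂ (2 * p) m)) p

/-- item stmt-HodgeConjecture-14568 · support · rank 9 · closed · proved by Summit.HodgeConjecture.HodgeConjecture.Theorems.galoisSieve_fermatHodgeModels_proof @ 69df68313cc7 (prover) · by planner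
sources: SerreGAGA1956, VoisinHodgeI2002
[support] (KNOWN theorem = the Literature named fact nonempty_hodgeModel RESTRICTED TO THE SECTOR:
Serre GAGA §2 analytification + de Rham + Hodge decomposition on the compact Kähler manifold Xⁿₘ(ℂ),
VoisinHodgeI2002 Thm 6.18; reduction in tree: HodgeModelExistenceDischarge) every smooth projective
Fermat variety has a Hodge model: ∀ n m X, 0 < m → IsFermatVariety n m X → IsSmoothProjective n X →
Nonempty (HodgeModel n X) — the anti-vacuity conjunct of HodgeConjectureFor on the sector. Stated
over HodgeConjecture.lean only (as EndoscopicMiddleDegree / OG6CharacterSectors do) so that the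
route's import cone carries no unproved fact; it replaces the shared item HodgeModels (∀ n X,
nonempty_hodgeModel n X, stmt-1943), which stays with its other routes and implies this one. Closes
by `fun n m X _ _ hX => nonempty_hodgeModel_holds hX` the day the fact lands. [difficulty: L] -/
@[route_item "route-HodgeConjecture-GaloisSieve", crux]
def FermatHodgeModels : Prop :=
  ∀ (n m : ℕ) (X : Literature.AlgebraicGeometry.Motives.SchemeOver ℂ), 0 < m → Literature.AlgebraicGeometry.Motives.IsFermatVariety n m X → Literature.AlgebraicGeometry.Motives.IsSmoothProjective n X → Nonempty (Literature.AlgebraicGeometry.HodgeTheory.HodgeModel n X)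

-- `FermatHodgeModels` holds: proved by `Summit.HodgeConjecture.HodgeConjecture.Theorems.galoisSieve_fermatHodgeModels_proof` @ 69df68313cc7 (its module imports this route file, so no `_holds` link can be stated here).

-- earlier EigenlineInduction (stmt-HodgeConjecture-14268, replaced 2026-08-16T03:56:41Z -> stmt-HodgeConjecture-14569): retired by None — CosetAlgebraicity → SporadicAlgebraicity → PairCancellation → FermatSurfaceEigenlines → HodgeEigenlines
/-- item stmt-HodgeConjecture-14569 · support · rank 9 · closed · proved by Summit.HodgeConjecture.HodgeConjecture.Theorems.galoisSieve_eigenlineInduction_proof @ b2df2b0ec845 (prover) · by planner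
sources: Shioda1979HodgeFermat, Aoki1987, AokiShioda1983
[support] [glue] (badge repair: makes the target HodgeEigenlines reachable from the cruxes; RESTATED
2026-08-16 to the repaired cut) BlockCancellation → FermatSurfaceEigenlines → CosetAlgebraicity →
SporadicAlgebraicity → HodgeEigenlines: every Hodge eigenline V(α), α ∈ 𝔅²ᵖₘ, of every Fermat
2p-fold is algebraic once DECOMPOSABLE characters reduce to lower dimension (BlockCancellation,
known), Fermat surfaces are Lefschetz (1,1) (FermatSurfaceEigenlines, known) and the INDECOMPOSABLE
characters of length ≥ 6 are handled on Hodge lines (C) and off them (S). Proof = pure logic, PROVED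
in the planner folder (sketch/Sketch.lean `theorem eigenlineInduction_holds : EigenlineInduction`,
lean check rc 0, 0 sorries, axioms propext/Classical.choice/Quot.sound; attached as evidence):
strong induction on p (Nat.strong_induction_on) — p = 1 is FermatSurfaceEigenlines; for p ≥ 2,
by_cases on FermatCharacter.IsDecomposable (univ.val.map α): decomposable ⇒ BlockCancellation
applied to the induction hypothesis at 0 < q < p; else by_cases on FermatCharacter.OnHodgeLine α:
CosetAlgebraicity or SporadicAlgebraicity (trichotomy by excluded middle, no sieve needed). Closes
by filing that proof verbatim -/
@[route_item "route-HodgeConjecture-GaloisSieve", crux]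
def EigenlineInduction : Prop :=
  BlockCancellation → FermatSurfaceEigenlines → CosetAlgebraicity → SporadicAlgebraicity → HodgeEigenlines

-- `EigenlineInduction` holds: proved by `Summit.HodgeConjecture.HodgeConjecture.Theorems.galoisSieve_eigenlineInduction_proof` @ b2df2b0ec845 (its module imports this route file, so no `_holds` link can be stated here).

-- earlier Assembly (stmt-HodgeConjecture-13240, replaced 2026-08-15T20:48:07Z -> stmt-HodgeConjecture-13966): retired by None — CosetAlgebraicity → SporadicAlgebraicity → PairCancellation → FermatSurfaceEigenlines → EigenspaceInputs → HypersurfaceLefschetz → HodgeModels → SectorComplement → _root_.HodgeConjecture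
-- earlier Assembly (stmt-HodgeConjecture-13966, replaced 2026-08-16T03:31:53Z -> stmt-HodgeConjecture-14566): retired by None — CosetAlgebraicity → SporadicAlgebraicity → PairCancellation → FermatSurfaceEigenlines → EigenspaceInputs → HypersurfaceLefschetz → HodgeModels → EigenlineAssembly → SectorComplement → _root_.HodgeConjecture
-- earlier Assembly (stmt-HodgeConjecture-14566, replaced 2026-08-16T03:56:41Z -> stmt-HodgeConjecture-14570): retired by None — BlockCancellation → FermatSurfaceEigenlines → CosetAlgebraicity → SporadicAlgebraicity → EigenspaceInputs → HypersurfaceLefschetz → EigenlineAssembly → FermatHodgeModels → SectorComplement → _root_.HodgeConjecture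
/-- item stmt-HodgeConjecture-14570 · assembly · rank 1 · closed · proved by Summit.HodgeConjecture.HodgeConjecture.Theorems.galoisSieve_assembly_proof @ 56db29b4b4db (prover) · by planner
sources: Shioda1979PJA, Ran1980, Deligne2000
[assembly] EigenlineInduction → BlockCancellation → FermatSurfaceEigenlines → CosetAlgebraicity →
SporadicAlgebraicity → EigenspaceInputs → HypersurfaceLefschetz → EigenlineAssembly →
FermatHodgeModels → SectorComplement → HodgeConjecture (the chain of the deciding theorem `closes`
as a Prop; closable by one line from it: fun hI hK hB hC hS hE hL hA hM hSC => closes hI hK hB hC hS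
hE hL hA hM hSC). -/
@[route_item "route-HodgeConjecture-GaloisSieve"]
def Assembly : Prop :=
  EigenlineInduction → BlockCancellation → FermatSurfaceEigenlines → CosetAlgebraicity → SporadicAlgebraicity → EigenspaceInputs → HypersurfaceLefschetz → EigenlineAssembly → FermatHodgeModels → SectorComplement → _root_.HodgeConjecture

-- `Assembly` holds: proved by `Summit.HodgeConjecture.HodgeConjecture.Theorems.galoisSieve_assembly_proof` @ 56db29b4b4db (its module imports this route file, so no `_holds` link can be stated here).

-- records of items no longer active in this route (dropped / restated):
-- earlier PairCancellation (stmt-HodgeConjecture-13235, replaced 2026-08-15T20:17:35Z -> stmt-HodgeConjecture-13727): retired by None — ∀ p : ℕ, 0 < p → ∀ (m : ℕ) [NeZero m], (∀ β : Fin (2 * p + 2) → ZMod m, Literature.AlgebraicGeometry.HodgeTheory.FermatCharacter.IsHodge β → Literature.AlgebraicGeometry.HodgeTheory.fermatEigenspace m β (2 * p) ≤ Literature.AlgebraicGeometry.HodgeTheory.algebraicCla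
-- earlier PairCancellation (stmt-HodgeConjecture-13727, replaced 2026-08-16T03:31:53Z -> stmt-HodgeConjecture-14567): retired by None — ∀ p : ℕ, 0 < p → ∀ (m : ℕ) [NeZero m], (∀ β : Fin (2 * p + 2) → ZMod m, Literature.AlgebraicGeometry.HodgeTheory.FermatCharacter.IsHodge β → Literature.AlgebraicGeometry.HodgeTheory.fermatEigenspace m β (2 * p) ≤ Literature.AlgebraicGeometry.HodgeTheory.algebraicCla
-- earlier HodgeModels (stmt-HodgeConjecture-1943, replaced 2026-08-16T03:31:53Z -> stmt-HodgeConjecture-14568): proved by Summit.HodgeConjecture.HodgeConjecture.Theorems.nodalSupport_hodgeModels_proof @ 6468568b8792 — ∀ (n : ℕ) (X : Literature.AlgebraicGeometry.Motives.SchemeOver ℂ), Literature.AlgebraicGeometry.HodgeTheory.nonempty_hodgeModel n X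

/-! D-0027 §2.1 — DECIDING THEOREM (planner-authored via `route open/edit --closes-file`; by planner-rbadge-HodgeConjecture-GaloisSieve-b29e92cf-0 2026-08-16T03:56:41Z):
its hypotheses are this route's items and its conclusion the sub-problem Statement (glue_lint), and it elaborates with this file. -/

@[closes "route-HodgeConjecture-GaloisSieve"] theorem closes (hI : EigenlineInduction) (hK : BlockCancellation) (hB : FermatSurfaceEigenlines)
    (hC : CosetAlgebraicity) (hS : SporadicAlgebraicity) (hE : EigenspaceInputs)
    (hL : HypersurfaceLefschetz) (hA : EigenlineAssembly) (hM : FermatHodgeModels)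
    (hSC : SectorComplement) : _root_.HodgeConjecture :=
  -- items only: Step 1 = hI (glue to the target HodgeEigenlines), Step 2 = hA (sector algebraicity) with the
  -- model conjunct hM, Step 3 = the declared sector frame hSC
  hSC (fun n m X hm hFV hX => ⟨hM n m X hm hFV hX, hA (hI hK hB hC hS) hL hE n m X hm hFV hX⟩)

end Summit.HodgeConjecture.HodgeConjecture.Theses.GaloisSieve
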